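import Summits.ABC.StewartYu.PadicG3ParVD
import Literature.NumberTheory.EllipticCurves.BSDWave0Proofs
import HarnessLib

/-!
# The `p`-adic Gen-3 parameter record v2 (corrected family `…V`) — part VE: the conditioning allowance and (C0′)

Support file (plain theorems; no named facts). Continues `PadicG3ParVD`:
* `AcondV s ν ≤ 2^ν·(52/100)·Zp + (22/100)·Zp + 2 + CondFloorV ν` for `ν ≤ n`, `s ≤ ŜG` (under `½ ≤ θ₀`):
  the nodes term `(2^{ν+1}XsV s+1)(TV s+1)·(log p/(p−1))` (`XsV s·(TV s+1) ≤ 4gXV·LgV + 2^s gXV + 8LgV + 2`; the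
  `2^s g XV` part is the floor-phase range, kept as `CondFloorV ν = 2^{ν+1}·2^{ŜG}·g·XV·(log p/(p−1))`),
  the `t·log 2N` term (`≤ 0.15·Zp`) and `4 LgV log p ≤ Zp/16`;
* **(C0′) `order_budgetV`**: if `8·2ⁿ·Zp + CondFloorV n ≤ U` then
  `AY1V + AcondV s ν + 2ⁿ·(logKV 0 + ADV E + 1) < U` (`ν ≤ n`, `s ≤ ŜG`, `0 ≤ E ≤ W_LV`, `½ ≤ θ₀`, `N_q ≤ 2ⁿK`).
  At `m = 0` (the v2 branch) `CondFloorV n ≤ 2^{2n+27}·g²·XV·K₀·N-type·(log p/(p−1))` is of headline size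
  (`log p/(p−1) ≤ 2 log p/p`); its comparison with `c₂ⁿ·(p/log p)·Ω·W⁺` belongs to the headline lemma.

## References
* [Nesterenko2003] Yu. V. Nesterenko, LNM 1819 (2003) — §4.2 (4.30)–(4.31).
-/

noncomputable section

open Finset Real

namespace Summit.ABC.StewartYu

namespace PadicG3Par

variable {n : ℕ} (P : PadicG3Par n)

/-! ### The conditioning allowance -/

/-- `log p/(p − 1) ≤ 1` and `0 ≤ log p/(p−1)`. [folklore] -/
theorem kappa_le_one : Real.log P.p / (P.p - 1) ≤ 1 ∧ 0 ≤ Real.log P.p / (P.p - 1) := by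
  have hp : (2 : ℝ) ≤ P.p := by exact_mod_cast P.two_le_p
  have h1 : Real.log (P.p : ℝ) ≤ P.p - 1 := Real.log_le_sub_one_of_pos (by linarith)
  exact ⟨(div_le_one (by linarith)).mpr h1, div_nonneg P.log_p_pos.le (by linarith)⟩

/-- `TV s + 1 ≤ 8 LgV/2^s + 2` (real). [folklore] -/
theorem TV_add_one_le (s : ℕ) : (P.TV s : ℝ) + 1 ≤ 8 * P.LgV / 2 ^ s + 2 := by
  have h1 : P.TV s ≤ max 1 (8 * P.LgV / 2 ^ s) := le_rfl
  have h2 : ((8 * P.LgV / 2 ^ s : ℕ) : ℝ) ≤ 8 * (P.LgV : ℝ) / 2 ^ s := by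
    have := Nat.cast_div_le (m := 8 * P.LgV) (n := 2 ^ s) (α := ℝ)
    push_cast at this; exact this
  have h3 : (P.TV s : ℝ) ≤ 1 + 8 * P.LgV / 2 ^ s := by
    rcases le_max_iff.mp h1 with h | h
    · have : (P.TV s : ℝ) ≤ 1 := by exact_mod_cast h
      have : (0 : ℝ) ≤ 8 * P.LgV / 2 ^ s := by positivity
      linarith
    · have : (P.TV s : ℝ) ≤ ((8 * P.LgV / 2 ^ s : ℕ) : ℝ) := by exact_mod_cast h
      linarith
  linarith

/-- `XsV s · (TV s + 1) ≤ 4 g XV LgV + 2^s g XV + 8 LgV + 2`. [folklore] -/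
theorem XsV_mul_le (s : ℕ) :
    (P.XsV s : ℝ) * (P.TV s + 1) ≤ 4 * P.g * P.XV * P.LgV + 2 ^ s * P.g * P.XV + 8 * P.LgV + 2 := by
  have h1 := P.XsV_le s
  have h2 := P.TV_add_one_le s
  have hg : 0 ≤ P.g := by linarith [P.one_le_g]
  have hX : (0 : ℝ) ≤ P.XV := by positivity
  have hL : (0 : ℝ) ≤ P.LgV := by positivity
  have h2s : (0 : ℝ) < 2 ^ s := by positivity
  have ha : (0 : ℝ) ≤ P.XsV s := by positivity
  have hb : (0 : ℝ) ≤ P.TV s + 1 := by positivity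
  calc (P.XsV s : ℝ) * (P.TV s + 1) ≤ (2 ^ s * P.g * P.XV / 2 + 1) * (8 * P.LgV / 2 ^ s + 2) :=
        mul_le_mul h1 h2 hb (by positivity)
    _ = 4 * P.g * P.XV * P.LgV + 2 ^ s * P.g * P.XV + 8 * P.LgV / 2 ^ s + 2 := by
        field_simp; ring
    _ ≤ 4 * P.g * P.XV * P.LgV + 2 ^ s * P.g * P.XV + 8 * P.LgV + 2 := by
        have : 8 * (P.LgV : ℝ) / 2 ^ s ≤ 8 * P.LgV := by
          rw [div_le_iff₀ h2s]
          have : (1 : ℝ) ≤ 2 ^ s := one_le_pow₀ (by norm_num)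
          nlinarith
        linarith

/-- (a) the nodes term: `(2^{ν+1}XsV s + 1)(TV s + 1)·(log p/(p−1)) ≤ 2^ν·(52/100)·Zp + Zp/256 + 2 + CondFloorV ν`
for `s ≤ ŜG`. [folklore] -/
theorem AcondV_nodes_le {s : ℕ} (hs : s ≤ P.SdG) (ν : ℕ) :
    (2 ^ (ν + 1) * (P.XsV s : ℝ) + 1) * (P.TV s + 1) * (Real.log P.p / (P.p - 1)) ≤
      2 ^ ν * ((52 / 100) * P.Zp) + P.Zp / 256 + 2 + P.CondFloorV ν := by
  obtain ⟨hκ1, hκ0⟩ := P.kappa_le_one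
  set κ := Real.log P.p / (P.p - 1) with hκ
  have hXs := P.XsV_mul_le s
  have hT := P.TV_add_one_le s
  obtain ⟨hGt, _, hLt, hGL, hXL⟩ := P.tinyV
  have hZ := P.Zp_facts.1
  have hG16 := P.sixteen_le_G
  have hg : 0 ≤ P.g := by linarith [P.one_le_g]
  have hX : (0 : ℝ) ≤ P.XV := by positivity
  have hL : (0 : ℝ) ≤ P.LgV := by positivity
  have h2ν : (0 : ℝ) < 2 ^ ν := by positivity
  have h2s1 : (1 : ℝ) ≤ 2 ^ s := one_le_pow₀ (by norm_num)
  have h2sS : (2 : ℝ) ^ s ≤ 2 ^ P.SdG := pow_le_pow_right₀ (by norm_num) hs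
  -- `g XV LgV = Zp/G ≤ Zp/16`
  have hgXL : P.g * P.XV * P.LgV ≤ P.Zp / 16 := by
    unfold Zp; rw [le_div_iff₀ (by norm_num)]
    have h0 : 0 ≤ P.g * P.XV * P.LgV := by positivity
    nlinarith
  have hT8 : (P.TV s : ℝ) + 1 ≤ 8 * P.LgV + 2 := by
    have : 8 * (P.LgV : ℝ) / 2 ^ s ≤ 8 * P.LgV := by
      rw [div_le_iff₀ (by positivity)]; nlinarith
    linarith
  -- expand
  have e : (2 ^ (ν + 1) * (P.XsV s : ℝ) + 1) * (P.TV s + 1) =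
      2 * 2 ^ ν * ((P.XsV s : ℝ) * (P.TV s + 1)) + (P.TV s + 1) := by rw [pow_succ]; ring
  have hmain : (2 ^ (ν + 1) * (P.XsV s : ℝ) + 1) * (P.TV s + 1) ≤
      2 ^ ν * (8 * P.g * P.XV * P.LgV + 16 * P.LgV + 4) + 2 ^ (ν + 1) * 2 ^ P.SdG * P.g * P.XV +
        (8 * P.LgV + 2) := by
    rw [e]
    have h1 : 2 * 2 ^ ν * ((P.XsV s : ℝ) * (P.TV s + 1)) ≤
        2 * 2 ^ ν * (4 * P.g * P.XV * P.LgV + 2 ^ s * P.g * P.XV + 8 * P.LgV + 2) :=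
      mul_le_mul_of_nonneg_left hXs (by positivity)
    have h2 : (2 : ℝ) ^ s * P.g * P.XV ≤ 2 ^ P.SdG * P.g * P.XV := by gcongr
    have h3 : 2 * 2 ^ ν * ((2 : ℝ) ^ s * P.g * P.XV) ≤ 2 ^ (ν + 1) * 2 ^ P.SdG * P.g * P.XV := by
      rw [pow_succ]; nlinarith [mul_nonneg h2ν.le (sub_nonneg.mpr h2)]
    nlinarith
  -- multiply by `κ ≤ 1` (all terms nonnegative), keeping `κ` on the floor term
  have hA0 : 0 ≤ 2 ^ ν * (8 * P.g * P.XV * P.LgV + 16 * P.LgV + 4) + (8 * (P.LgV : ℝ) + 2) := by positivity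
  have hF0 : 0 ≤ (2 : ℝ) ^ (ν + 1) * 2 ^ P.SdG * P.g * P.XV := by positivity
  have hN0 : 0 ≤ (2 ^ (ν + 1) * (P.XsV s : ℝ) + 1) * (P.TV s + 1) := by positivity
  have step : (2 ^ (ν + 1) * (P.XsV s : ℝ) + 1) * (P.TV s + 1) * κ ≤
      (2 ^ ν * (8 * P.g * P.XV * P.LgV + 16 * P.LgV + 4) + (8 * P.LgV + 2)) * 1 +
        2 ^ (ν + 1) * 2 ^ P.SdG * P.g * P.XV * κ := by
    have := mul_le_mul_of_nonneg_right hmain hκ0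
    have h2 : (2 ^ ν * (8 * P.g * P.XV * P.LgV + 16 * P.LgV + 4) + (8 * (P.LgV : ℝ) + 2)) * κ ≤
        (2 ^ ν * (8 * P.g * P.XV * P.LgV + 16 * P.LgV + 4) + (8 * P.LgV + 2)) * 1 :=
      mul_le_mul_of_nonneg_left hκ1 hA0
    nlinarith
  have hCF : 2 ^ (ν + 1) * 2 ^ P.SdG * P.g * P.XV * κ = P.CondFloorV ν := by unfold CondFloorV; rw [hκ]
  rw [hCF] at step
  -- bound the `Zp`-part
  have hB : 2 ^ ν * (8 * P.g * P.XV * P.LgV + 16 * P.LgV + 4) ≤ 2 ^ ν * ((52 / 100) * P.Zp) := by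
    apply mul_le_mul_of_nonneg_left _ h2ν.le
    have hZ36 := P.Zp_ge
    nlinarith
  have hC : 8 * (P.LgV : ℝ) + 2 ≤ P.Zp / 256 + 2 := by linarith
  linarith

/-- (b) `log(2(2^{ν+1}XsV s + 1)) ≤ (ν + s + 3) log 2 + G/16 + XV/4`. [folklore] -/
theorem AcondV_log_le (s ν : ℕ) :
    Real.log (2 * (2 ^ (ν + 1) * (P.XsV s : ℝ) + 1)) ≤ ((ν : ℝ) + s + 3) * Real.log 2 + P.G / 16 + P.XV / 4 := by
  have h1 := P.XsV_le s
  have hg1 := P.one_le_g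
  have hX := P.XV_ge_128
  obtain ⟨hgG, hlogg⟩ := P.g_le_G_div
  have hlogX := P.log_XV_le
  have h2 : (0 : ℝ) < 2 ^ (ν + 1) := by positivity
  have h2s : (1 : ℝ) ≤ 2 ^ s := one_le_pow₀ (by norm_num)
  have hgX : (128 : ℝ) ≤ P.g * P.XV := by nlinarith
  -- `2(2^{ν+1} XsV + 1) ≤ 2^{ν+s+3} g XV`
  have hN : 2 * (2 ^ (ν + 1) * (P.XsV s : ℝ) + 1) ≤ 2 ^ (ν + s + 3) * (P.g * P.XV) := by
    have e : (2 : ℝ) ^ (ν + s + 3) = 2 ^ (ν + 1) * 2 ^ s * 4 := by rw [pow_add, pow_add]; ring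
    rw [e]
    have h3 : 2 ^ (ν + 1) * (P.XsV s : ℝ) ≤ 2 ^ (ν + 1) * (2 ^ s * P.g * P.XV / 2 + 1) :=
      mul_le_mul_of_nonneg_left h1 h2.le
    have hB : (128 : ℝ) ≤ 2 ^ s * (P.g * P.XV) := by nlinarith
    have hA2 : (2 : ℝ) ≤ 2 ^ (ν + 1) := by
      calc (2 : ℝ) = 2 ^ 1 := by norm_num
        _ ≤ 2 ^ (ν + 1) := pow_le_pow_right₀ (by norm_num) (by omega)
    have hAB := mul_le_mul_of_nonneg_left hB h2.le
    have e2 : 2 ^ (ν + 1) * (2 ^ s * P.g * (P.XV : ℝ) / 2 + 1) = 2 ^ (ν + 1) * (2 ^ s * (P.g * P.XV)) / 2 + 2 ^ (ν + 1) := by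
      ring
    rw [e2] at h3
    nlinarith
  have hpos : 0 < 2 * (2 ^ (ν + 1) * (P.XsV s : ℝ) + 1) := by positivity
  calc Real.log (2 * (2 ^ (ν + 1) * (P.XsV s : ℝ) + 1))
      ≤ Real.log (2 ^ (ν + s + 3) * (P.g * P.XV)) := Real.log_le_log hpos hN
    _ = (ν + s + 3 : ℕ) * Real.log 2 + (Real.log P.g + Real.log P.XV) := by
        rw [Real.log_mul (by positivity) (by positivity), Real.log_pow,
          Real.log_mul (by positivity) (by positivity)]
    _ ≤ ((ν : ℝ) + s + 3) * Real.log 2 + P.G / 16 + P.XV / 4 := by push_cast; linarith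

set_option maxHeartbeats 400000 in
/-- (c) the `t · log 2N` term: `(TV s + 1)·log(2(2^{ν+1}XsV s + 1)) ≤ (15/100)·Zp` for `ν ≤ n`, `s ≤ ŜG`. [folklore] -/
theorem AcondV_tlog_le {s ν : ℕ} (hs : s ≤ P.SdG) (hν : ν ≤ n) :
    ((P.TV s : ℝ) + 1) * Real.log (2 * (2 ^ (ν + 1) * (P.XsV s : ℝ) + 1)) ≤ (15 / 100) * P.Zp := by
  have hlog := P.AcondV_log_le s ν
  have hT := P.TV_add_one_le s
  obtain ⟨hGt, _, hLt, hGL, hXL⟩ := P.tinyV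
  have hZ := P.Zp_facts.1
  have hG16 := P.sixteen_le_G
  have hn := P.n_le
  have hνn : (ν : ℝ) ≤ n := by exact_mod_cast hν
  have hsS : (s : ℝ) ≤ P.SdG := by exact_mod_cast hs
  have hS4 : 4 * ((P.SdG : ℝ) + 2) ≤ P.LgV := by exact_mod_cast P.four_SdG_le_LgV
  have hl2 : Real.log 2 ≤ 7 / 10 := by have := Real.log_two_lt_d9; linarith
  have hl20 : 0 ≤ Real.log 2 := Real.log_nonneg (by norm_num)
  have hX0 : (0 : ℝ) ≤ P.XV := by positivity
  have hL0 : (0 : ℝ) ≤ P.LgV := by positivity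
  have hG0 : (0 : ℝ) ≤ P.G := by linarith
  have h2s : (0 : ℝ) < 2 ^ s := by positivity
  -- `s/2^s ≤ 1/2`
  have hs2 : (s : ℝ) / 2 ^ s ≤ 1 / 2 := by
    rw [div_le_iff₀ h2s]
    have : ((2 * s : ℕ) : ℝ) ≤ ((2 ^ s : ℕ) : ℝ) := by exact_mod_cast Literature.NumberTheory.EllipticCurves.two_mul_le_two_pow s
    push_cast at this; linarith
  have hlog0 : 0 ≤ Real.log (2 * (2 ^ (ν + 1) * (P.XsV s : ℝ) + 1)) := by
    apply Real.log_nonneg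
    have : (1 : ℝ) ≤ P.XsV s := by exact_mod_cast P.one_le_XsV s
    have : (1 : ℝ) ≤ 2 ^ (ν + 1) := one_le_pow₀ (by norm_num)
    nlinarith
  have hT0 : (0 : ℝ) ≤ P.TV s + 1 := by positivity
  -- `(TV+1) · log 2N ≤ (8LgV/2^s + 2) · ((ν+s+3) log 2 + G/16 + XV/4)`
  have h1 : ((P.TV s : ℝ) + 1) * Real.log (2 * (2 ^ (ν + 1) * (P.XsV s : ℝ) + 1)) ≤
      (8 * P.LgV / 2 ^ s + 2) * (((ν : ℝ) + s + 3) * Real.log 2 + P.G / 16 + P.XV / 4) :=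
    mul_le_mul hT hlog hlog0 (by positivity)
  -- split: `(8LgV/2^s)·s·log 2 ≤ 8 LgV · (1/2) · (7/10)`
  have hA : 8 * (P.LgV : ℝ) / 2 ^ s * ((s : ℝ) * Real.log 2) ≤ 8 * P.LgV * (1 / 2) * (7 / 10) := by
    have e : 8 * (P.LgV : ℝ) / 2 ^ s * ((s : ℝ) * Real.log 2) = 8 * P.LgV * ((s : ℝ) / 2 ^ s) * Real.log 2 := by
      field_simp
    rw [e]
    have h0 : 0 ≤ 8 * (P.LgV : ℝ) := by positivity
    have h5 : 8 * (P.LgV : ℝ) * ((s : ℝ) / 2 ^ s) ≤ 8 * P.LgV * (1 / 2) := mul_le_mul_of_nonneg_left hs2 h0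
    have hs0 : 0 ≤ 8 * (P.LgV : ℝ) * ((s : ℝ) / 2 ^ s) := by positivity
    calc 8 * (P.LgV : ℝ) * ((s : ℝ) / 2 ^ s) * Real.log 2 ≤ 8 * P.LgV * ((s : ℝ) / 2 ^ s) * (7 / 10) :=
          mul_le_mul_of_nonneg_left hl2 hs0
      _ ≤ 8 * P.LgV * (1 / 2) * (7 / 10) := mul_le_mul_of_nonneg_right h5 (by norm_num)
  have hB : 8 * (P.LgV : ℝ) / 2 ^ s ≤ 8 * P.LgV := by
    rw [div_le_iff₀ h2s]; have : (1 : ℝ) ≤ 2 ^ s := one_le_pow₀ (by norm_num); nlinarith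
  -- assemble: everything in `Zp` units
  have hrest0 : 0 ≤ ((ν : ℝ) + 3) * Real.log 2 + P.G / 16 + P.XV / 4 := by positivity
  have h2 : (8 * P.LgV / 2 ^ s + 2) * (((ν : ℝ) + s + 3) * Real.log 2 + P.G / 16 + P.XV / 4) =
      8 * P.LgV / 2 ^ s * ((s : ℝ) * Real.log 2) +
        8 * P.LgV / 2 ^ s * (((ν : ℝ) + 3) * Real.log 2 + P.G / 16 + P.XV / 4) +
        2 * (((ν : ℝ) + s + 3) * Real.log 2 + P.G / 16 + P.XV / 4) := by ring
  have h3 : 8 * (P.LgV : ℝ) / 2 ^ s * (((ν : ℝ) + 3) * Real.log 2 + P.G / 16 + P.XV / 4) ≤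
      8 * P.LgV * (((n : ℝ) + 3) * (7 / 10) + P.G / 16 + P.XV / 4) := by
    have : ((ν : ℝ) + 3) * Real.log 2 + P.G / 16 + P.XV / 4 ≤ ((n : ℝ) + 3) * (7 / 10) + P.G / 16 + P.XV / 4 := by
      nlinarith
    calc 8 * (P.LgV : ℝ) / 2 ^ s * (((ν : ℝ) + 3) * Real.log 2 + P.G / 16 + P.XV / 4)
        ≤ 8 * P.LgV * (((ν : ℝ) + 3) * Real.log 2 + P.G / 16 + P.XV / 4) := mul_le_mul_of_nonneg_right hB hrest0
      _ ≤ 8 * P.LgV * (((n : ℝ) + 3) * (7 / 10) + P.G / 16 + P.XV / 4) :=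
          mul_le_mul_of_nonneg_left this (by positivity)
  have h4 : 2 * (((ν : ℝ) + s + 3) * Real.log 2 + P.G / 16 + P.XV / 4) ≤
      2 * (((n : ℝ) + P.SdG + 3) * (7 / 10) + P.G / 16 + P.XV / 4) := by nlinarith
  -- numeric pieces in `Zp` units
  have hL25 : (2 : ℝ) ^ 25 ≤ P.LgV := by
    have h1 : 2 ^ 25 ≤ 2 ^ (n + 25) := Nat.pow_le_pow_right (by norm_num) (by omega)
    exact_mod_cast h1.trans P.two_pow_le_LgV
  have hXV : (P.XV : ℝ) ≤ P.Zp / 2 ^ 29 := by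
    have h16 : (P.XV : ℝ) * P.LgV * 16 ≤ P.Zp := (le_div_iff₀ (by norm_num)).mp hXL
    have h25 : (P.XV : ℝ) * 2 ^ 25 ≤ P.XV * P.LgV := mul_le_mul_of_nonneg_left hL25 hX0
    have h25' := mul_le_mul_of_nonneg_right h25 (by norm_num : (0:ℝ) ≤ 16)
    rw [le_div_iff₀ (by positivity)]
    have e29 : (P.XV : ℝ) * 2 ^ 29 = (P.XV : ℝ) * 2 ^ 25 * 16 := by ring
    rw [e29]
    exact h25'.trans h16
  have hT1 : 8 * (P.LgV : ℝ) * (1 / 2) * (7 / 10) ≤ P.Zp / 512 := by linarith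
  have hT2 : 8 * (P.LgV : ℝ) * (((n : ℝ) + 3) * (7 / 10) + P.G / 16 + P.XV / 4) ≤ (14 / 100) * P.Zp := by
    have e : 8 * (P.LgV : ℝ) * (((n : ℝ) + 3) * (7 / 10) + P.G / 16 + P.XV / 4) =
        (56 / 10) * (((n : ℝ) + 3) * P.LgV) + (P.G * P.LgV) / 2 + 2 * (P.XV * P.LgV) := by ring
    have hn3 : ((n : ℝ) + 3) * P.LgV ≤ P.G * P.LgV / 8 + 2 * P.LgV := by
      have := mul_le_mul_of_nonneg_right (show (n : ℝ) + 3 ≤ P.G / 8 + 2 by linarith) hL0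
      linarith
    rw [e]; linarith
  have hT3 : 2 * (((n : ℝ) + P.SdG + 3) * (7 / 10) + P.G / 16 + P.XV / 4) ≤ P.Zp / 1000 + 5 := by
    have hSd : (P.SdG : ℝ) ≤ P.LgV / 4 := by linarith
    linarith
  have htot : (8 * P.LgV / 2 ^ s + 2) * (((ν : ℝ) + s + 3) * Real.log 2 + P.G / 16 + P.XV / 4) ≤
      P.Zp / 512 + (14 / 100) * P.Zp + (P.Zp / 1000 + 5) :=
    calc (8 * P.LgV / 2 ^ s + 2) * (((ν : ℝ) + s + 3) * Real.log 2 + P.G / 16 + P.XV / 4)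
        = 8 * P.LgV / 2 ^ s * ((s : ℝ) * Real.log 2) +
            8 * P.LgV / 2 ^ s * (((ν : ℝ) + 3) * Real.log 2 + P.G / 16 + P.XV / 4) +
            2 * (((ν : ℝ) + s + 3) * Real.log 2 + P.G / 16 + P.XV / 4) := h2
      _ ≤ 8 * P.LgV * (1 / 2) * (7 / 10) + 8 * P.LgV * (((n : ℝ) + 3) * (7 / 10) + P.G / 16 + P.XV / 4) +
            2 * (((n : ℝ) + P.SdG + 3) * (7 / 10) + P.G / 16 + P.XV / 4) := add_le_add (add_le_add hA h3) h4
      _ ≤ P.Zp / 512 + (14 / 100) * P.Zp + (P.Zp / 1000 + 5) := add_le_add (add_le_add hT1 hT2) hT3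
  have hZ36 := P.Zp_ge
  have hfin : P.Zp / 512 + (14 / 100) * P.Zp + (P.Zp / 1000 + 5) ≤ (15 / 100) * P.Zp := by
    have h36 : (2 : ℝ) ^ 36 = 68719476736 := by norm_num
    rw [h36] at hZ36
    linarith only [hZ36]
  exact h1.trans (htot.trans hfin)

/-- **`AcondV s ν ≤ 2^ν·(52/100)·Zp + (22/100)·Zp + 2 + CondFloorV ν`** for `ν ≤ n`, `s ≤ ŜG`, under `½ ≤ θ₀`
(`4 LgV log p ≤ 8 G LgV ≤ Zp/16`). [folklore] -/
theorem AcondV_le (hθ : 1 / 2 ≤ P.θ₀) {s ν : ℕ} (hs : s ≤ P.SdG) (hν : ν ≤ n) :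
    P.AcondV s ν ≤ 2 ^ ν * ((52 / 100) * P.Zp) + (22 / 100) * P.Zp + 2 + P.CondFloorV ν := by
  have ha := P.AcondV_nodes_le hs ν
  have hc := P.AcondV_tlog_le hs hν
  obtain ⟨_, _, _, hGL, _⟩ := P.tinyV
  have hlogp : Real.log P.p ≤ 2 * P.G := by
    have := P.θ₀_log_le_G; have := P.log_p_pos; nlinarith
  have hL0 : (0 : ℝ) ≤ P.LgV := by positivity
  have hd : 4 * (P.LgV : ℝ) * Real.log P.p ≤ P.Zp / 16 := by nlinarith
  unfold AcondV
  linarith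

/-- **(C0′) THE ORDER BUDGET** (U-branch): if `8·2ⁿ·Zp + CondFloorV n ≤ U` then
`AY1V + AcondV s ν + 2ⁿ·(logKV 0 + ADV E + 1) < U` for `ν ≤ n`, `s ≤ ŜG`. [cite: Nesterenko2003, §4.2 (4.30)–(4.31)] -/
theorem order_budgetV (hθ : 1 / 2 ≤ P.θ₀) (hNqK : P.Nq ≤ 2 ^ n * P.K) {s ν : ℕ} (hs : s ≤ P.SdG) (hν : ν ≤ n)
    {E : ℝ} (hE0 : 0 ≤ E) (hE : E ≤ P.WLV) {U : ℝ} (hU : 8 * 2 ^ n * P.Zp + P.CondFloorV n ≤ U) :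
    P.AY1V + P.AcondV s ν + 2 ^ n * (P.logKV 0 + P.ADV E + 1) < U := by
  have hK := P.logKV_zero_le hθ hNqK hE0 hE
  have hA := P.AY1V_le
  have hc := P.AcondV_le hθ hs hν
  have hZ := P.Zp_facts.1
  have hZ36 := P.Zp_ge
  have h2n : (2 : ℝ) ≤ 2 ^ n := by
    calc (2 : ℝ) = 2 ^ 1 := by norm_num
      _ ≤ 2 ^ n := pow_le_pow_right₀ (by norm_num) P.hn
  have h2νn : (2 : ℝ) ^ ν ≤ 2 ^ n := pow_le_pow_right₀ (by norm_num) hν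
  have h2n0 : (0 : ℝ) ≤ 2 ^ n := by positivity
  -- `CondFloorV ν ≤ CondFloorV n`
  have hCF : P.CondFloorV ν ≤ P.CondFloorV n := by
    unfold CondFloorV
    obtain ⟨_, hκ0⟩ := P.kappa_le_one
    have hg : 0 ≤ P.g := by linarith [P.one_le_g]
    have h0 : 0 ≤ (2 : ℝ) ^ P.SdG * P.g * P.XV * (Real.log P.p / (P.p - 1)) := by positivity
    have h1 : (2 : ℝ) ^ (ν + 1) ≤ 2 ^ (n + 1) := pow_le_pow_right₀ (by norm_num) (by omega)
    have e1 : (2 : ℝ) ^ (ν + 1) * 2 ^ P.SdG * P.g * P.XV * (Real.log P.p / (P.p - 1)) =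
        2 ^ (ν + 1) * (2 ^ P.SdG * P.g * P.XV * (Real.log P.p / (P.p - 1))) := by ring
    have e2 : (2 : ℝ) ^ (n + 1) * 2 ^ P.SdG * P.g * P.XV * (Real.log P.p / (P.p - 1)) =
        2 ^ (n + 1) * (2 ^ P.SdG * P.g * P.XV * (Real.log P.p / (P.p - 1))) := by ring
    rw [e1, e2]
    exact mul_le_mul_of_nonneg_right h1 h0
  have := mul_le_mul_of_nonneg_left hK h2n0
  nlinarith

end PadicG3Par

end Summit.ABC.StewartYu
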